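import Summits.ABC.IUTFork.Joshi.GeometricCase2Proofs

/-!
# Joshi's geometric case II — the VERBATIM Thm. 12.18.1 under (12.15.1) as typed: a dichotomy
# (arXiv:2401.13508 v4, §§12.15–12.18; proof-only companion of `Joshi/GeometricCase2.lean`, no new definitions)

Record file of the abc-iut cell, branch E (rung LADDER-ABC:A2.E; seat abc-iut-E-t53, §12 lineage). Everything here is DERIVED from
the typed signature of `Joshi/GeometricCase2.lean` (bib `Joshi2024ATS3`, UNREFEREED, disputed in print: `Mochizuki2024JoshiReport`) and
its companion `Joshi/GeometricCase2Proofs.lean`; nothing is asserted about [IUTchIII] Cor. 3.12, about abc, or about the correctness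
of any author. LOCATED, not adjudicated: the sentences below are about OUR TYPING (binders verbatim).

MAIN RESULT (`HeightDatum.thm12181AsPrinted_iff_degenerate`). For EVERY height datum `G` satisfying Joshi's (12.14.1)
(`HeightSubadditive`) and (12.15.1) AS TYPED, i.e. for all `m ∈ ℤ` (`HeightLogLinkBound`, p. 155 l. 9 «for `m ∈ ℤ`»), every
number of singular points `n > 0`, every domain locus `L` (§12.16) and every monodromy datum `M` (§12.17, irreducible or not):

  `G.Thm12181AsPrinted L M ↔ (L.carrier = ∅ ∨ L.size = ⊤)` —

the sentence displayed as Thm. 12.18.1 («for … ANY choice of `(g̃_1,…,g̃_{ℓ*}) ∈ Θ_classical(D)`, one has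
`|Θ_classical(D)| ≥ ∑_{s,j} h(γ̃_s^{(j)}) ≥ …`» for the lifts `γ̃_s^{(j)}` of §12.17) holds EXACTLY for the degenerate loci: empty
`Θ_classical(D)`, or `|Θ_classical(D)| = +∞`.

MECHANISM. Print (p. 156 l. 23–25): «let `γ̃_s^{(j)} ∈ S̃L₂(ℤ)` be an ARBITRARY lift of `ρ_ℓ(γ_s^{j²})`». A lift is determined only
modulo `ker(Y∞ → X∞) = ⟨ϕ∞⟩` ((12.3.1)): `IsLiftOf` is stable under the log-link shift `g̃ ↦ g̃·ϕ∞^k` (`IsLiftOf.mul_frob_zpow`), lift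
families always exist (`MonodromyDatum.exists_isLiftFamily`, from `proj_surjective`), and (12.15.1)-as-typed is EXACT additivity
`h(g̃·ϕ∞^m) = h(g̃) + π·m` (E-t36's `heightLogLinkBound_iff_additive`), so `∑_{s,j} h` over lift families is UNBOUNDED ABOVE
(`hSum_mul_frob_zpow`: `+ n·ℓ*·π` per unit shift; `exists_isLiftFamily_lt_hSum`). Hence the verbatim first inequality
`|Θ_classical(D)| ≥ ∑ h(γ̃)` for arbitrary lifts forces `|Θ_classical(D)| = ⊤` once `Θ_classical(D) ≠ ∅`
(`size_eq_top_of_thm12181AsPrinted`); conversely an empty carrier or `size = ⊤` makes the verbatim sentence hold under (12.14.1).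

CONSEQUENCES recorded here:
* `not_thm12181AsPrinted_of_size_ne_top` + `DomainLocus.size_ne_top_of_finite`: for every non-empty locus of finite size — in
  particular every FINITE non-empty `Θ_classical(D)` — the verbatim sentence fails under (12.15.1)-as-typed, for every height datum
  and every monodromy datum; E-t36's toy witness (`Model.asPrinted_not_derivable`, p432140) and E-t63's irreducible-monodromy
  witness (`GeometricCase2IrreducibleWitness`, p436170) are instances of this model-free statement.
* `exists_shift_not_mem_carrier`: under (12.15.1)-as-typed a locus of finite size is never closed under log-link shifts of a family
  (vertical moves of the log-Θ-lattice, §12.9) — membership `γ̃ ∈ Θ_classical(D)`, the hypothesis OUR READING `Thm12181Reading`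
  adds (E-t36, located L3), therefore PINS the log-link coordinate of the lifts up to a bounded window.
* The honest universal cover `S̃L₂(ℝ)` (automorphy-factor model `Geo.coverModel`, p433554) with the Zhang/ABKP displacement height
  `Geo.CoverModel.displacementHeightDatum` (p435167/p435971) satisfies (12.14.1) ∧ (12.15.1) as THEOREMS
  (`heightSubadditive_displacement`, `heightLogLinkBound_displacement`), so there the dichotomy is unconditional — a two-line
  instantiation of `thm12181AsPrinted_iff_degenerate`, deliberately NOT in this file (kept to the single BUILT parent
  `GeometricCase2Proofs`; to be appended once that module's olean is coherent on the farm).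
OUR READING is untouched: it holds under (12.14.1) alone (`HeightDatum.thm12181Reading_of_subadditive`, main file), and (12.15.1) is
not used by the printed proof (E-lit EL-129) — but for the VERBATIM sentence (12.15.1) is decisive, as shown here. On the sign
question of (12.15.1) («m ∈ ℤ» forces a SIGNED `h`: `HeightDatum.not_heightLogLinkBound_of_nonneg`, p435971; [Zhang 2001] not held,
acq-11316) nothing here depends on a sign convention beyond the typed `ℤ`-form. [claim: Joshi2024ATS3, status: disputed]
-/

noncomputable section

open scoped MatrixGroups

namespace Summit.ABC.IUTFork.Joshi.ATS3.GeoLocus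

variable {Y : Type} [Group Y]

namespace HeightDatum

/-- Log-link shifts do not move the image in `X∞ = SL₂(ℝ)`: `proj(g̃·ϕ∞^k) = proj(g̃)` (`ϕ∞ ∈ ker`, (12.3.1)). [folklore] -/
theorem proj_mul_frob_zpow (G : HeightDatum Y) (g : Y) (k : ℤ) : G.proj (g * G.frob ^ k) = G.proj g := by
  rw [map_mul, map_zpow, G.proj_frob, one_zpow, mul_one]

/-- A lift of `A ∈ SL₂(ℤ/ℓ)` (§12.17, p. 156 l. 23–25 «an arbitrary lift») stays a lift of `A` after any log-link shift
`g̃ ↦ g̃·ϕ∞^k`, `k ∈ ℤ`: lifts are determined only modulo `⟨ϕ∞⟩`. [folklore] -/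
theorem IsLiftOf.mul_frob_zpow {G : HeightDatum Y} {g : Y} {A : SL(2, ZMod G.ell)} (hg : G.IsLiftOf g A) (k : ℤ) :
    G.IsLiftOf (g * G.frob ^ k) A := by
  obtain ⟨B, hB, hBA⟩ := hg
  exact ⟨B, (G.proj_mul_frob_zpow g k).trans hB, hBA⟩

/-- Lifts exist: every reduction mod `ℓ` of an integral matrix `B ∈ SL₂(ℤ)` has a lift in `Y∞` (`Y∞ → X∞` is onto, (12.3.1)).
[folklore] -/
theorem exists_isLiftOf (G : HeightDatum Y) (B : SL(2, ℤ)) :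
    ∃ g : Y, G.IsLiftOf g (Matrix.SpecialLinearGroup.map (Int.castRingHom (ZMod G.ell)) B) := by
  obtain ⟨g, hg⟩ := G.proj_surjective (Matrix.SpecialLinearGroup.map (Int.castRingHom ℝ) B)
  exact ⟨g, B, hg, rfl⟩

/-- Under (12.15.1) AS TYPED (all `m ∈ ℤ`, equivalently exact additivity), shifting every member of a family
`(g̃_{s,j})_{s∈S, j=1..ℓ*}` by `ϕ∞^k` adds `|S|·ℓ*·π·k` to `∑_{s,j} h(g̃_{s,j})`. [folklore] -/
theorem hSum_mul_frob_zpow (G : HeightDatum Y) (hll : G.HeightLogLinkBound) {n : ℕ} (γt : Fin n → Fin G.lstar → Y) (k : ℤ) :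
    G.hSum (fun s j => γt s j * G.frob ^ k) = G.hSum γt + ((n * G.lstar : ℕ) : ℝ) * (Real.pi * k) := by
  have hadd := (G.heightLogLinkBound_iff_additive).1 hll
  simp only [hSum, hadd, Finset.sum_add_distrib, Finset.sum_const, Finset.card_univ, Fintype.card_fin, nsmul_eq_mul,
    Nat.cast_mul]
  ring

end HeightDatum

namespace MonodromyDatum

variable {Pi : Type} [Group Pi] {genus n : ℕ}

/-- A family of lifts (§12.17) stays a family of lifts after a simultaneous log-link shift by `ϕ∞^k`. [folklore] -/
theorem IsLiftFamily.mul_frob_zpow {G : HeightDatum Y} {M : MonodromyDatum Pi genus n} {γt : Fin n → Fin G.lstar → Y}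
    (hγ : M.IsLiftFamily G γt) (k : ℤ) : M.IsLiftFamily G (fun s j => γt s j * G.frob ^ k) :=
  fun s j => (hγ s j).mul_frob_zpow k

/-- Lift families `(γ̃_s^{(j)})` of `(ρ_ℓ(γ_s)^{j²})` EXIST for every height datum and every monodromy datum (p. 156 l. 23–25:
«lifts exist since `SL₂(ℤ) → SL₂(ℤ/ℓ)` and `Y∞ → X∞` are onto» — here `ρ_ℓ = (mod ℓ) ∘ ρ` by definition, so `ρ(γ_s)^{j²}` is an
integral lift and `proj` is onto). [folklore] -/
theorem exists_isLiftFamily (G : HeightDatum Y) (M : MonodromyDatum Pi genus n) :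
    ∃ γt : Fin n → Fin G.lstar → Y, M.IsLiftFamily G γt := by
  choose g hg using fun B : SL(2, ℤ) => G.exists_isLiftOf B
  refine ⟨fun s j => g (M.rho (M.loop s) ^ (((j : ℕ) + 1) ^ 2)), fun s j => ?_⟩
  have hpow : M.rhoL G (M.loop s) ^ (((j : ℕ) + 1) ^ 2) =
      Matrix.SpecialLinearGroup.map (Int.castRingHom (ZMod G.ell)) (M.rho (M.loop s) ^ (((j : ℕ) + 1) ^ 2)) := by
    rw [map_pow]
    rfl
  rw [hpow]
  exact hg _

end MonodromyDatum

namespace HeightDatum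

variable (G : HeightDatum Y)

/-- Under (12.15.1) AS TYPED and `S ≠ ∅`, the sums `∑_{s,j} h(γ̃_s^{(j)})` over lift families are UNBOUNDED ABOVE: every real
`r` is exceeded by some family of lifts (shift any lift family far enough along the log-links). [folklore] -/
theorem exists_isLiftFamily_lt_hSum (hll : G.HeightLogLinkBound) {Pi : Type} [Group Pi] {genus n : ℕ} (hn : 0 < n)
    (M : MonodromyDatum Pi genus n) (r : ℝ) :
    ∃ γt : Fin n → Fin G.lstar → Y, M.IsLiftFamily G γt ∧ r < G.hSum γt := by
  obtain ⟨γ0, hγ0⟩ := M.exists_isLiftFamily G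
  have hc : 0 < ((n * G.lstar : ℕ) : ℝ) * Real.pi := by
    have : 0 < n * G.lstar := Nat.mul_pos hn G.lstar_pos
    positivity
  obtain ⟨k, hk⟩ := exists_nat_gt ((r - G.hSum γ0) / (((n * G.lstar : ℕ) : ℝ) * Real.pi))
  refine ⟨fun s j => γ0 s j * G.frob ^ (k : ℤ), hγ0.mul_frob_zpow (k : ℤ), ?_⟩
  rw [G.hSum_mul_frob_zpow hll γ0 k, Int.cast_natCast]
  have h1 : r - G.hSum γ0 < (k : ℝ) * (((n * G.lstar : ℕ) : ℝ) * Real.pi) := (div_lt_iff₀ hc).1 hk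
  have h2 : (k : ℝ) * (((n * G.lstar : ℕ) : ℝ) * Real.pi) = ((n * G.lstar : ℕ) : ℝ) * (Real.pi * k) := by ring
  linarith

/-- LOCATED, kernel form: under (12.15.1) AS TYPED and `S ≠ ∅`, the VERBATIM Thm. 12.18.1 forces `|Θ_classical(D)| = +∞` as soon
as `Θ_classical(D) ≠ ∅` — its first inequality bounds `|Θ_classical(D)|` below by the unbounded sums over arbitrary lifts.
[folklore] -/
theorem size_eq_top_of_thm12181AsPrinted (hll : G.HeightLogLinkBound) {Pi : Type} [Group Pi] {genus n : ℕ} (hn : 0 < n)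
    (L : G.DomainLocus n) (M : MonodromyDatum Pi genus n) (hne : L.carrier.Nonempty) (hyp : G.Thm12181AsPrinted L M) :
    L.size = ⊤ := by
  by_contra htop
  have hbot : L.size ≠ ⊥ := fun h => hne.ne_empty (L.size_eq_bot_iff.1 h)
  obtain ⟨γt, hγt, hlt⟩ := G.exists_isLiftFamily_lt_hSum hll hn M L.size.toReal
  have h1 := ((G.thm12181AsPrinted_iff L M hne).1 hyp γt hγt).1
  rw [← EReal.coe_toReal htop hbot, EReal.coe_le_coe_iff] at h1
  linarith

/-- Negative form: under (12.15.1) AS TYPED and `S ≠ ∅`, NO non-empty locus of finite size satisfies the verbatim Thm. 12.18.1 —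
for any height datum and any monodromy datum (irreducibility of `ρ_ℓ` plays no role). [folklore] -/
theorem not_thm12181AsPrinted_of_size_ne_top (hll : G.HeightLogLinkBound) {Pi : Type} [Group Pi] {genus n : ℕ} (hn : 0 < n)
    (L : G.DomainLocus n) (M : MonodromyDatum Pi genus n) (hne : L.carrier.Nonempty) (htop : L.size ≠ ⊤) :
    ¬ G.Thm12181AsPrinted L M :=
  fun hyp => htop (G.size_eq_top_of_thm12181AsPrinted hll hn L M hne hyp)

/-- **DICHOTOMY.** Under Joshi's (12.14.1) and (12.15.1) AS TYPED, for `S ≠ ∅`, every domain locus and every monodromy datum: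
the sentence displayed as Thm. 12.18.1 holds IF AND ONLY IF the locus is degenerate — `Θ_classical(D) = ∅` (vacuous binder) or
`|Θ_classical(D)| = +∞` (vacuous first inequality; the second is (12.14.1)). [folklore] -/
theorem thm12181AsPrinted_iff_degenerate (hsub : G.HeightSubadditive) (hll : G.HeightLogLinkBound) {Pi : Type} [Group Pi]
    {genus n : ℕ} (hn : 0 < n) (L : G.DomainLocus n) (M : MonodromyDatum Pi genus n) :
    G.Thm12181AsPrinted L M ↔ (L.carrier = ∅ ∨ L.size = ⊤) := by
  constructor
  · intro hyp
    by_cases hne : L.carrier.Nonempty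
    · exact Or.inr (G.size_eq_top_of_thm12181AsPrinted hll hn L M hne hyp)
    · exact Or.inl (Set.not_nonempty_iff_eq_empty.1 hne)
  · rintro (hempty | htop)
    · intro g hg
      rw [hempty] at hg
      exact ((Set.mem_empty_iff_false g).1 hg).elim
    · intro _ _ γt _
      refine ⟨?_, (G.h_totalProd_le hsub hn γt).trans (G.prodSum_le_hSum hsub γt)⟩
      rw [htop]
      exact le_top

namespace DomainLocus

variable {G} {n : ℕ} (L : G.DomainLocus n)

/-- A uniform bound on the members' sums bounds `|Θ_classical(D)|` (Def. 12.16.1 is a supremum). [folklore] -/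
theorem size_le_of_forall_le {B : ℝ} (hB : ∀ g ∈ L.carrier, G.hSum g ≤ B) : L.size ≤ (B : EReal) :=
  iSup₂_le fun g hg => EReal.coe_le_coe_iff.2 (hB g hg)

/-- If the sums `∑ h` are bounded above on `Θ_classical(D)` then `|Θ_classical(D)| < +∞`. [folklore] -/
theorem size_ne_top_of_bddAbove (hB : BddAbove (G.hSum '' L.carrier)) : L.size ≠ ⊤ := by
  obtain ⟨B, hB⟩ := hB
  exact ne_top_of_le_ne_top (EReal.coe_ne_top B) (L.size_le_of_forall_le fun g hg => hB ⟨g, hg, rfl⟩)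

/-- A FINITE locus has `|Θ_classical(D)| < +∞`. [folklore] -/
theorem size_ne_top_of_finite (hfin : L.carrier.Finite) : L.size ≠ ⊤ :=
  L.size_ne_top_of_bddAbove (hfin.image G.hSum).bddAbove

end DomainLocus

/-- Every FINITE non-empty locus violates the verbatim Thm. 12.18.1 under (12.15.1) AS TYPED (`S ≠ ∅`; any height datum, any
monodromy datum) — the model-free form of the witnesses `Model.asPrinted_not_derivable` (E-t36) and
`GeometricCase2IrreducibleWitness` (E-t63). [folklore] -/
theorem not_thm12181AsPrinted_of_finite (hll : G.HeightLogLinkBound) {Pi : Type} [Group Pi] {genus n : ℕ} (hn : 0 < n)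
    (L : G.DomainLocus n) (M : MonodromyDatum Pi genus n) (hne : L.carrier.Nonempty) (hfin : L.carrier.Finite) :
    ¬ G.Thm12181AsPrinted L M :=
  G.not_thm12181AsPrinted_of_size_ne_top hll hn L M hne (L.size_ne_top_of_finite hfin)

/-- Under (12.15.1) AS TYPED (`S ≠ ∅`), a locus of finite size is never closed under log-link shifts: for every family `g̃` some
shift `g̃·ϕ∞^k` (`k ∈ ℕ`) lies OUTSIDE `Θ_classical(D)`. So the membership hypothesis of OUR READING pins the log-link coordinate
of the lifts up to a bounded window. [folklore] -/
theorem exists_shift_not_mem_carrier (hll : G.HeightLogLinkBound) {n : ℕ} (hn : 0 < n) (L : G.DomainLocus n)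
    (htop : L.size ≠ ⊤) (γt : Fin n → Fin G.lstar → Y) :
    ∃ k : ℕ, (fun s j => γt s j * G.frob ^ (k : ℤ)) ∉ L.carrier := by
  by_cases hne : L.carrier.Nonempty
  · have hbot : L.size ≠ ⊥ := fun h => hne.ne_empty (L.size_eq_bot_iff.1 h)
    have hc : 0 < ((n * G.lstar : ℕ) : ℝ) * Real.pi := by
      have : 0 < n * G.lstar := Nat.mul_pos hn G.lstar_pos
      positivity
    obtain ⟨k, hk⟩ := exists_nat_gt ((L.size.toReal - G.hSum γt) / (((n * G.lstar : ℕ) : ℝ) * Real.pi))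
    refine ⟨k, fun hmem => ?_⟩
    have h1 := L.hSum_le_size hmem
    rw [G.hSum_mul_frob_zpow hll γt k, Int.cast_natCast, ← EReal.coe_toReal htop hbot, EReal.coe_le_coe_iff] at h1
    have h2 : L.size.toReal - G.hSum γt < (k : ℝ) * (((n * G.lstar : ℕ) : ℝ) * Real.pi) := (div_lt_iff₀ hc).1 hk
    have h3 : (k : ℝ) * (((n * G.lstar : ℕ) : ℝ) * Real.pi) = ((n * G.lstar : ℕ) : ℝ) * (Real.pi * k) := by ring
    linarith
  · exact ⟨0, fun hmem => hne ⟨_, hmem⟩⟩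

end HeightDatum

end Summit.ABC.IUTFork.Joshi.ATS3.GeoLocus

end
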